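import Summits.AtomisticToContinuum.HydrodynamicLimit.Theorems.DiluteSelfConsistency.Negative.ProfileUniform
import Summits.AtomisticToContinuum.HydrodynamicLimit.Theorems.CollisionIsometryCLTMesoscopicLLNKernels

/-!
# `DiluteSelfConsistency`: the threshold is at most `(2η/M)^{1/3}` — tightness of `σ₀(η, profiles)` (stmt-3091)

Negative knowledge for the crux `ImplosionDichotomy.DiluteSelfConsistency` (stmt-AtomisticToContinuum-3091), from the
standing disprover's work file `Cruxes/DiluteSelfConsistency/Disproof.lean`
(refuter-cdisprove-stmt-AtomisticToContinuum-3091-0), sharpening `Negative/ProfileUniform.lean` from "`σ₀` cannot be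
uniform in the profiles" to a QUANTITATIVE ceiling valid for EVERY smooth positive profile triple.

`DiluteSelfConsistencyHoldsAt η a₀ θ₀ u₀ σ₀` is the crux's inner clause (the crux is literally
`∀ η > 0, ∀ continuous positive profiles, ∃ σ₀ > 0, DiluteSelfConsistencyHoldsAt η a₀ θ₀ u₀ σ₀`,
`diluteSelfConsistency_iff_holdsAt`). Main results:

* `not_holdsAt_of_lt` — there is an ABSOLUTE level `η* > 0` such that for all SMOOTH positive profiles `(a₀, θ₀, u₀)`,
  every `0 < η ≤ η*` and every `σ₀` with `σ₀³ > 2η/M` (`M = sup a₀/∫a₀`), the inner clause FAILS: at the reduced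
  diameter `σ = (2η/M)^{1/3} < σ₀` the pinned initial density `rhoLim (profileOf a₀) σ` already has packing
  `≥ (3/4)·M σ³ = (3/2)η > η` at the activity maximum (statics error `16e²v₁M²σ³ ≤ M/4` because `Mv₁σ³ = 2v₁η ≤ λ*`),
  and an ADMISSIBLE classical solution from these data exists (`exists_admissible_of_small`: η₀-uniform statics tie +
  local classical existence + Alexander flows);
* `sigma0_pow_le` — contrapositive: ANY threshold that works satisfies `σ₀³ ≤ 2η / M`. Together with
  `not_denseExcursionAtTimeZero` (for fixed profiles the initial packing is `O(σ³)`) this pins the only freedom a proof of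
  the crux has: `σ₀(η, P) ≍ (η/M_P)^{1/3}` is necessary, and whether it is sufficient is decided dynamically (the
  `DenseExcursion` heart), never at `t = 0`.
-/

noncomputable section

namespace Summit.AtomisticToContinuum.HydrodynamicLimit.Theorems

open MeasureTheory Filter Set Topology Metric
open Literature.MathematicalPhysics.KineticTheory Literature.Analysis.FluidPDE
open Literature.Analysis.FunctionSpaces
open Summit.AtomisticToContinuum.HydrodynamicLimit.Theses.ImplosionDichotomy

/-- The INNER CLAUSE of the crux: dilute self-consistency at level `η` for the profiles `(a₀, θ₀, u₀)` below the
threshold `σ₀` (verbatim the part of `DiluteSelfConsistency` after `∃ σ₀, 0 < σ₀ ∧`). -/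
def DiluteSelfConsistencyHoldsAt (η : ℝ) (a₀ θ₀ : T3 → ℝ) (u₀ : T3 → V3) (σ₀ : ℝ) : Prop :=
  ∀ σ : ℝ, 0 < σ → σ < σ₀ → ∀ (T : ℝ) (ρ θ : ℝ → T3 → ℝ) (u : ℝ → T3 → V3), IsHardSphereEulerSolution σ T ρ u θ →
    ∀ Φ : (N : ℕ) → HardSphereFlow (Torus.geometry (Fin 3)) (hsDiameter σ N) (N + 1),
      TendstoHydroFieldsAt (fun N => localGibbsLaw σ a₀ u₀ θ₀ N (Φ N)) Φ ρ u θ 0 →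
        ∀ t ∈ Ico 0 T, ∀ x, ρ t x * σ ^ 3 < η

/-- The crux is `∀ η > 0, ∀ profiles, ∃ σ₀ > 0, DiluteSelfConsistencyHoldsAt η a₀ θ₀ u₀ σ₀` (definitional). -/
theorem diluteSelfConsistency_iff_holdsAt :
    DiluteSelfConsistency ↔ ∀ η : ℝ, 0 < η → ∀ (a₀ θ₀ : T3 → ℝ) (u₀ : T3 → V3), Continuous a₀ → Continuous θ₀ →
      Continuous u₀ → (∀ x, 0 < a₀ x) → (∀ x, 0 < θ₀ x) →
        ∃ σ₀ : ℝ, 0 < σ₀ ∧ DiluteSelfConsistencyHoldsAt η a₀ θ₀ u₀ σ₀ :=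
  Iff.rfl

/-- The inner clause is antitone in the threshold. [folklore] -/
theorem DiluteSelfConsistencyHoldsAt.anti {η : ℝ} {a₀ θ₀ : T3 → ℝ} {u₀ : T3 → V3} {σ₀ σ₁ : ℝ} (hle : σ₁ ≤ σ₀)
    (h : DiluteSelfConsistencyHoldsAt η a₀ θ₀ u₀ σ₀) : DiluteSelfConsistencyHoldsAt η a₀ θ₀ u₀ σ₁ :=
  fun σ hσ hσ₁ => h σ hσ (hσ₁.trans_le hle)

open DiluteSelfConsistencyProfileUniformNeg

/-- **THE THRESHOLD CEILING (negative form).** There is an absolute level `η* > 0` such that for all SMOOTH positive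
profiles `(a₀, θ₀, u₀)`, every level `0 < η ≤ η*` and every `σ₀` with `2η/M < σ₀³` (`M = sup a₀/∫a₀`), the crux's
inner clause at `(η, a₀, θ₀, u₀, σ₀)` FAILS: at `σ = (2η/M)^{1/3} < σ₀` (so `M v₁ σ³ = 2v₁η ≤ λ*`) the pinned initial
density has packing `≥ (3/2)η` at the activity maximum (`abs_rhoLim_sub_β_le`: error `≤ M/4`), and an admissible
classical solution from it exists (`exists_admissible_of_small`). [folklore] -/
theorem not_holdsAt_of_lt :
    ∃ ηstar : ℝ, 0 < ηstar ∧ ∀ {a₀ θ₀ : T3 → ℝ} {u₀ : T3 → V3} (ha : Torus.IsSmooth a₀) (_hθ : Torus.IsSmooth θ₀)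
      (_hu : Torus.IsSmooth u₀) (ha0 : ∀ x, 0 < a₀ x) (_hθ0 : ∀ x, 0 < θ₀ x) {η : ℝ}, 0 < η → η ≤ ηstar →
      ∀ {σ₀ : ℝ}, 2 * η / (profileOf a₀ ha.continuous ha0).M < σ₀ ^ 3 →
        ¬ DiluteSelfConsistencyHoldsAt η a₀ θ₀ u₀ σ₀ := by
  -- equation of state, local existence and admissibility under explicit smallness
  obtain ⟨η₀, hη₀, F, hFa, hFeq, -⟩ := hsEosLowDensity_proof
  obtain ⟨η₁, hη₁, ADM⟩ := exists_admissible_of_small hη₀ hFa hFeq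
  have he0 : 0 < Real.exp 1 := Real.exp_pos 1
  have hv : 0 < v₁ := v₁_pos
  set lamstar : ℝ := min (1 / (64 * Real.exp 1 ^ 2)) (4 / 5 * v₁ * η₁) with hlamstar
  have hlamstar0 : 0 < lamstar := lt_min (by positivity) (by positivity)
  refine ⟨min (lamstar / (2 * v₁)) (1 / 128), lt_min (by positivity) (by norm_num), ?_⟩
  intro a₀ θ₀ u₀ ha hθ hu ha0 hθ0 η hη hηle σ₀ hcon hD
  set P := profileOf a₀ ha.continuous ha0 with hP
  have hM1 : 1 ≤ P.M := MesoLLN.one_le_M P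
  have hM0 : 0 < P.M := P.M_pos
  -- the scale `λ = 2 v₁ η ≤ λ*`
  set lam : ℝ := 2 * v₁ * η with hlam
  have hlam0 : 0 < lam := by positivity
  have hlamle : lam ≤ lamstar := by
    have h1 : η ≤ lamstar / (2 * v₁) := hηle.trans (min_le_left _ _)
    rw [le_div_iff₀ (by positivity)] at h1
    rw [hlam]
    linarith
  have hlam1 : lam * (64 * Real.exp 1 ^ 2) ≤ 1 := by
    have h1 : lamstar ≤ 1 / (64 * Real.exp 1 ^ 2) := min_le_left _ _
    rw [le_div_iff₀ (by positivity)] at h1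
    exact (mul_le_mul_of_nonneg_right hlamle (by positivity)).trans h1
  have hlam2 : lam ≤ 4 / 5 * v₁ * η₁ := hlamle.trans (min_le_right _ _)
  -- the bad reduced diameter `σ³ = 2η/M`
  set σ : ℝ := (2 * η / P.M) ^ ((3 : ℕ) : ℝ)⁻¹ with hσdef
  have hσ : 0 < σ := Real.rpow_pos_of_pos (by positivity) _
  have hσ3 : σ ^ 3 = 2 * η / P.M := by
    rw [hσdef, Real.rpow_inv_natCast_pow (by positivity) (by norm_num)]
  have hσ₀ : 0 ≤ σ₀ := by
    by_contra h'
    push Not at h'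
    have h1 : σ₀ ^ 3 ≤ 0 := Odd.pow_nonpos (by decide) h'.le
    have h2 : 0 < 2 * η / P.M := by positivity
    linarith
  have hσσ₀ : σ < σ₀ := lt_of_pow_lt_pow_left₀ 3 hσ₀ (by rwa [hσ3])
  have hσ4 : σ ≤ 1 / 4 := by
    refine le_of_pow_le_pow_left₀ (by norm_num : (3 : ℕ) ≠ 0) (by norm_num) ?_
    rw [hσ3, div_le_iff₀ hM0]
    have h1 : η ≤ 1 / 128 := hηle.trans (min_le_right _ _)
    nlinarith
  have hσ2 : σ < 1 / 2 := by linarith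
  have hMvσ : P.M * v₁ * σ ^ 3 = lam := by
    rw [hσ3, hlam]
    field_simp
  have hMσ : P.M * σ ^ 3 = 2 * η := by
    rw [hσ3]
    field_simp
  -- smallness, statics error, the activity maximum
  obtain ⟨hsmall, h16⟩ := numerics hM0 hlam0.le hMvσ hlam1
  have hPs : SmallDensity P σ :=
    UniformLGC.smallDensity_of_eta_le (Mstar := 2 * P.M) hσ hσ2 (by linarith) hsmall
  have hdev : ∀ x, |rhoLim P σ x - P.β x| ≤ P.M / 4 := fun x =>
    (PolynomialCompressionStatics.abs_rhoLim_sub_β_le hPs x).trans h16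
  obtain ⟨x₀, -, hx₀⟩ := isCompact_univ.exists_isMaxOn univ_nonempty P.continuous.continuousOn
  have hβx₀ : P.M ≤ P.β x₀ :=
    csSup_le (range_nonempty _) (by rintro _ ⟨y, rfl⟩; exact (isMaxOn_iff.mp hx₀) y (mem_univ y))
  have hpack_low : η < rhoLim P σ x₀ * σ ^ 3 := by
    have h := (abs_le.1 (hdev x₀)).1
    have h1 : 3 / 4 * P.M ≤ rhoLim P σ x₀ := by linarith
    calc η < 3 / 4 * (2 * η) := by linarith
      _ = 3 / 4 * P.M * σ ^ 3 := by rw [← hMσ]; ring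
      _ ≤ rhoLim P σ x₀ * σ ^ 3 := mul_le_mul_of_nonneg_right h1 (pow_pos hσ 3).le
  have hpack_up : ∀ x, rhoLim P σ x * σ ^ 3 ≤ η₁ := by
    intro x
    have h := (abs_le.1 (hdev x)).2
    have hβ := P.le_M x
    have h1 : rhoLim P σ x ≤ 5 / 4 * P.M := by linarith
    have h2 : η ≤ 2 / 5 * η₁ := by
      have h' : v₁ * η ≤ v₁ * (2 / 5 * η₁) := by rw [hlam] at hlam2; linarith
      exact le_of_mul_le_mul_left h' hv
    calc rhoLim P σ x * σ ^ 3 ≤ 5 / 4 * P.M * σ ^ 3 := mul_le_mul_of_nonneg_right h1 (pow_pos hσ 3).le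
      _ = 5 / 4 * (2 * η) := by rw [← hMσ]; ring
      _ ≤ η₁ := by linarith
  -- an admissible classical solution from the pinned data; the inner clause fails at `t = 0`, `x = x₀`
  obtain ⟨T, hT, ρ, θ, u, hE, hρ0, -, -, ⟨Φ⟩, htie⟩ := ADM ha hθ hu ha0 hθ0 hσ hσ2 hsmall hpack_up
  have hlt := hD σ hσ hσσ₀ T ρ θ u hE Φ (htie Φ) 0 ⟨le_rfl, hT⟩ x₀
  rw [hρ0] at hlt
  exact absurd hlt (not_lt.2 hpack_low.le)

/-- **TIGHTNESS OF THE THRESHOLD** (`σ₀(η, profiles)³ ≤ 2η/M`): with the absolute level `η*` of `not_holdsAt_of_lt`,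
for all smooth positive profiles and every level `0 < η ≤ η*`, ANY threshold `σ₀` for which the crux's inner clause
holds satisfies `σ₀³ ≤ 2η / M`, `M = sup a₀/∫a₀`. So a proof of the crux must produce `σ₀ ≲ (η/M_P)^{1/3}` — the
profile dependence is quantitatively forced by equilibrium statics — and (by `not_denseExcursionAtTimeZero`) whether
such a threshold WORKS is decided only dynamically. [folklore] -/
theorem sigma0_pow_le :
    ∃ ηstar : ℝ, 0 < ηstar ∧ ∀ {a₀ θ₀ : T3 → ℝ} {u₀ : T3 → V3} (ha : Torus.IsSmooth a₀) (_hθ : Torus.IsSmooth θ₀)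
      (_hu : Torus.IsSmooth u₀) (ha0 : ∀ x, 0 < a₀ x) (_hθ0 : ∀ x, 0 < θ₀ x) {η : ℝ}, 0 < η → η ≤ ηstar →
      ∀ {σ₀ : ℝ}, DiluteSelfConsistencyHoldsAt η a₀ θ₀ u₀ σ₀ →
        σ₀ ^ 3 ≤ 2 * η / (profileOf a₀ ha.continuous ha0).M := by
  obtain ⟨ηstar, hηstar, H⟩ := not_holdsAt_of_lt
  refine ⟨ηstar, hηstar, ?_⟩
  intro a₀ θ₀ u₀ ha hθ hu ha0 hθ0 η hη hηle σ₀ hD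
  by_contra hcon
  push Not at hcon
  exact H ha hθ hu ha0 hθ0 hη hηle hcon hD

end Summit.AtomisticToContinuum.HydrodynamicLimit.Theorems

end
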